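/-
Copyright: cell `pub-balaban-gaps` (G2), seat ne6 (row NE7b), `prover-pub-balaban-gaps-ne6-g15-0`. Project licence.
-/
import Summits.QuantumFields.BalabanUV.T4Continuum.Spine.NE7b.CompactFibreCreationFloorSUN
import Summits.QuantumFields.BalabanUV.T4Continuum.Spine.NE7b.CompactFibreWindowSUNRate
import Summits.QuantumFields.BalabanUV.T4Continuum.Spine.NE7b.CompactFibreWindowSUNExplicit

/-!
# THE (n)-CARRIER'S CREATION-STEP PRICE ON THE `SU(N)` PRODUCT FIBRE WITH THE LETTER AT PRINT's RATE FOLDED, ALL `N`: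
# `∫ F·w·e^{−I} ≤ exp(i₀ − (λ∕2)δ′² + #bonds·((N² − 1)·log η⁻¹ + c))·(∫F dκ)·∫ G·w·e^{−I}` (soft `c`, V29) and, for `N ≥ 1`, with the EXPLICIT `c_N` of V33
# (row NE7b, node U5c; MODEL, [folklore]; the all-`N` form of `CompactFibreWindowSU2Rate.creationPrice_SU2_sharp`)

Cell `pub-balaban-gaps` (G2 spine census, V34) for the `pub-balaban` T⁴ crux NE7b (`T4WeightBudget.RelWeightBound`; NOT PRINTED, NOT PROVED).  Junction only: V32
`CompactFibreCreationFloorSUN.creationPrice_SUN_of_volumeLetter` (letter abstract) + V29 `CompactFibreWindowSUNRate.exists_neg_log_pi_sball_le_sharp` (`#B·((N² − 1)·log η⁻¹ + c)`)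
+ V33 `CompactFibreWindowSUNExplicit.neg_log_pi_sball_le_explicit` (`c = c_N` explicit).  No `def`; zero `sorry`; nothing of Bałaban's asserted.

WHAT IS PROVED ([folklore]): **`exists_creationPrice_SUN_sharp`** (all `N`, soft `c ≥ 0`), **`creationPrice_SUN_explicit`** (`N ≥ 1`, `c_N = ((N² − 1)∕2)·log N + N²·log(16π + 2) + log(2N + 1) − log(4π)`),
`creationPrice_SUN_explicit_factor_le_exp_neg` (the step sells `e^{−P}` once `P + i₀ + #B·((N² − 1)·log η⁻¹ + c_N) ≤ (λ∕2)δ′²` and `∫F dκ ≤ 1`).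

HONEST REMARKS.  MODEL; the three (A3) letters `λ` (print's `γ₀W⁻¹`, `γ₀` = GAPS G-B9-09), `i₀`'s inputs `ρ, s` (`CompactFibreWindowCentredSUN`) and the identification stay owed; NC-NE7b-α UNRULED.
BY-NAME EFFECT ON THE WALL: NONE.  NE7b NOT PRINTED ∕ NOT PROVED; spine PROVED 0∕9; rung (B)+1 on ONE finite T⁴ — NOT infinite volume, NOT the mass gap, NOT Clay.
HONEST DEPENDENCY: continuum YM on T⁴ ⇐ BetaPertH ∧ nine spine estimates (0/9 proved); BetaPertH ⇐ (D1) ∧ (D4) ∧ CAP+tail;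
G-an2-4 gates asym, D1 and NE2/3/4.  This file changes none of it.
-/

set_option autoImplicit false

noncomputable section

open MeasureTheory Real Finset
open scoped Matrix.Norms.Frobenius
open Literature.MathematicalPhysics.QuantumFieldTheory (haarProbability)
open Summit.QuantumFields.BalabanUV.T4Continuum.NE7b.CompactFibreCreationFloorSUN (creationPrice_SUN_of_volumeLetter creationPrice_factor_le_exp_neg_of_volumeLetter)
open Summit.QuantumFields.BalabanUV.T4Continuum.NE7b.CompactFibreWindowSUNRate (exists_neg_log_pi_sball_le_sharp)
open Summit.QuantumFields.BalabanUV.T4Continuum.NE7b.CompactFibreWindowSUNExplicit (neg_log_pi_sball_le_explicit)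

namespace Summit.QuantumFields.BalabanUV.T4Continuum.NE7b.CompactFibreCreationFloorSUNSharp

variable {N : ℕ} {B : Type*} [Fintype B] {Y : Type*} [MeasurableSpace Y] (μ : Measure Y) [SFinite μ]

/-- **THE CREATION-STEP PRICE WITH THE LETTER AT PRINT's RATE, ALL `N` (soft constant)**: there is `c ≥ 0` such that for every `0 < η ≤ 2` the hypotheses of V32's
`creationPrice_SUN_of_volumeLetter` other than the letter give `∫ F·w·e^{−I} ≤ exp(i₀ − (λ∕2)δ′² + #bonds·((N² − 1)·log η⁻¹ + c))·(∫F dκ)·∫ G·w·e^{−I}`. [folklore] -/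
theorem exists_creationPrice_SUN_sharp :
    ∃ c : ℝ, 0 ≤ c ∧ ∀ η : ℝ, 0 < η → η ≤ 2 →
      ∀ (F G : (B → Matrix.specialUnitaryGroup (Fin N) ℂ) → ℝ) (w : Y → ℝ) (I : (B → Matrix.specialUnitaryGroup (Fin N) ℂ) × Y → ℝ) (m₀ : Y → ℝ)
        (U₀ : Y → (B → Matrix.specialUnitaryGroup (Fin N) ℂ)) (i₀ lam δ' : ℝ),
        (∀ x, 0 ≤ F x) → (∀ x, 0 ≤ G x) → (∀ y, 0 ≤ w y) → 0 ≤ lam → 0 ≤ δ' →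
        (∀ x y, F x ≠ 0 → w y ≠ 0 → ∃ b : B, δ' ≤ ‖(((U₀ y b)⁻¹ * x b : Matrix.specialUnitaryGroup (Fin N) ℂ) : Matrix (Fin N) (Fin N) ℂ) - 1‖) →
        (∀ x y, F x ≠ 0 → w y ≠ 0 → m₀ y + lam / 2 * ∑ b, ‖(((U₀ y b)⁻¹ * x b : Matrix.specialUnitaryGroup (Fin N) ℂ) : Matrix (Fin N) (Fin N) ℂ) - 1‖ ^ 2 ≤ I (x, y)) →
        (∀ y v, w y ≠ 0 → v ∈ (Set.univ.pi fun _ : B => {U : Matrix.specialUnitaryGroup (Fin N) ℂ | ‖(U : Matrix (Fin N) (Fin N) ℂ) - 1‖ ≤ η}) → 1 ≤ G (U₀ y * v)) →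
        (∀ y v, w y ≠ 0 → v ∈ (Set.univ.pi fun _ : B => {U : Matrix.specialUnitaryGroup (Fin N) ℂ | ‖(U : Matrix (Fin N) (Fin N) ℂ) - 1‖ ≤ η}) → I (U₀ y * v, y) ≤ m₀ y + i₀) →
        Integrable F (Measure.pi fun _ : B => haarProbability (Matrix.specialUnitaryGroup (Fin N) ℂ)) →
        (∀ y, w y ≠ 0 → Integrable (fun x => G x * exp (-I (x, y))) (Measure.pi fun _ : B => haarProbability (Matrix.specialUnitaryGroup (Fin N) ℂ))) →
        Integrable (fun z : (B → Matrix.specialUnitaryGroup (Fin N) ℂ) × Y => F z.1 * w z.2 * exp (-I z)) ((Measure.pi fun _ : B => haarProbability (Matrix.specialUnitaryGroup (Fin N) ℂ)).prod μ) →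
        Integrable (fun z : (B → Matrix.specialUnitaryGroup (Fin N) ℂ) × Y => G z.1 * w z.2 * exp (-I z)) ((Measure.pi fun _ : B => haarProbability (Matrix.specialUnitaryGroup (Fin N) ℂ)).prod μ) →
        ∫ z, F z.1 * w z.2 * exp (-I z) ∂((Measure.pi fun _ : B => haarProbability (Matrix.specialUnitaryGroup (Fin N) ℂ)).prod μ) ≤
          exp (i₀ - lam / 2 * δ' ^ 2 + (Fintype.card B : ℝ) * (((N ^ 2 - 1 : ℕ) : ℝ) * Real.log η⁻¹ + c)) *
            (∫ x, F x ∂(Measure.pi fun _ : B => haarProbability (Matrix.specialUnitaryGroup (Fin N) ℂ))) *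
            ∫ z, G z.1 * w z.2 * exp (-I z) ∂((Measure.pi fun _ : B => haarProbability (Matrix.specialUnitaryGroup (Fin N) ℂ)).prod μ) := by
  obtain ⟨c, hc, h⟩ := exists_neg_log_pi_sball_le_sharp (N := N) (B := B)
  refine ⟨c, hc, fun η hη hη2 F G w I m₀ U₀ i₀ lam δ' hF0 hG0 hw0 hlam hδ hF hconv hGwin hIrel hFi hGI hA' hB' => ?_⟩
  obtain ⟨hpos, hlog⟩ := h η hη hη2
  exact creationPrice_SUN_of_volumeLetter μ F G w I m₀ U₀ hF0 hG0 hw0 hlam hδ hF hconv hGwin hIrel hpos hlog hFi hGI hA' hB'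

/-- **THE SAME WITH THE EXPLICIT CONSTANT, `N ≥ 1`**: for `0 < η ≤ 2`, `∫ F·w·e^{−I} ≤ exp(i₀ − (λ∕2)δ′² + #bonds·((N² − 1)·log η⁻¹ + c_N))·(∫F dκ)·∫ G·w·e^{−I}`,
`c_N = ((N² − 1)∕2)·log N + N²·log(16π + 2) + log(2N + 1) − log(4π)` (V33). [folklore] -/
theorem creationPrice_SUN_explicit [NeZero N] {η : ℝ} (hη : 0 < η) (hη2 : η ≤ 2) (F G : (B → Matrix.specialUnitaryGroup (Fin N) ℂ) → ℝ) (w : Y → ℝ)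
    (I : (B → Matrix.specialUnitaryGroup (Fin N) ℂ) × Y → ℝ) (m₀ : Y → ℝ) (U₀ : Y → (B → Matrix.specialUnitaryGroup (Fin N) ℂ))
    {i₀ lam δ' : ℝ} (hF0 : ∀ x, 0 ≤ F x) (hG0 : ∀ x, 0 ≤ G x) (hw0 : ∀ y, 0 ≤ w y) (hlam : 0 ≤ lam) (hδ : 0 ≤ δ')
    (hF : ∀ x y, F x ≠ 0 → w y ≠ 0 → ∃ b : B, δ' ≤ ‖(((U₀ y b)⁻¹ * x b : Matrix.specialUnitaryGroup (Fin N) ℂ) : Matrix (Fin N) (Fin N) ℂ) - 1‖)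
    (hconv : ∀ x y, F x ≠ 0 → w y ≠ 0 → m₀ y + lam / 2 * ∑ b, ‖(((U₀ y b)⁻¹ * x b : Matrix.specialUnitaryGroup (Fin N) ℂ) : Matrix (Fin N) (Fin N) ℂ) - 1‖ ^ 2 ≤ I (x, y))
    (hGwin : ∀ y v, w y ≠ 0 → v ∈ (Set.univ.pi fun _ : B => {U : Matrix.specialUnitaryGroup (Fin N) ℂ | ‖(U : Matrix (Fin N) (Fin N) ℂ) - 1‖ ≤ η}) → 1 ≤ G (U₀ y * v))
    (hIrel : ∀ y v, w y ≠ 0 → v ∈ (Set.univ.pi fun _ : B => {U : Matrix.specialUnitaryGroup (Fin N) ℂ | ‖(U : Matrix (Fin N) (Fin N) ℂ) - 1‖ ≤ η}) → I (U₀ y * v, y) ≤ m₀ y + i₀)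
    (hFi : Integrable F (Measure.pi fun _ : B => haarProbability (Matrix.specialUnitaryGroup (Fin N) ℂ)))
    (hGI : ∀ y, w y ≠ 0 → Integrable (fun x => G x * exp (-I (x, y))) (Measure.pi fun _ : B => haarProbability (Matrix.specialUnitaryGroup (Fin N) ℂ)))
    (hA' : Integrable (fun z : (B → Matrix.specialUnitaryGroup (Fin N) ℂ) × Y => F z.1 * w z.2 * exp (-I z)) ((Measure.pi fun _ : B => haarProbability (Matrix.specialUnitaryGroup (Fin N) ℂ)).prod μ))
    (hB' : Integrable (fun z : (B → Matrix.specialUnitaryGroup (Fin N) ℂ) × Y => G z.1 * w z.2 * exp (-I z)) ((Measure.pi fun _ : B => haarProbability (Matrix.specialUnitaryGroup (Fin N) ℂ)).prod μ)) :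
    ∫ z, F z.1 * w z.2 * exp (-I z) ∂((Measure.pi fun _ : B => haarProbability (Matrix.specialUnitaryGroup (Fin N) ℂ)).prod μ) ≤
      exp (i₀ - lam / 2 * δ' ^ 2 + (Fintype.card B : ℝ) * (((N : ℝ) ^ 2 - 1) * Real.log η⁻¹ + (((N : ℝ) ^ 2 - 1) / 2 * Real.log N + (N : ℝ) ^ 2 * Real.log (16 * π + 2) + Real.log (2 * N + 1) - Real.log (4 * π)))) *
        (∫ x, F x ∂(Measure.pi fun _ : B => haarProbability (Matrix.specialUnitaryGroup (Fin N) ℂ))) *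
        ∫ z, G z.1 * w z.2 * exp (-I z) ∂((Measure.pi fun _ : B => haarProbability (Matrix.specialUnitaryGroup (Fin N) ℂ)).prod μ) := by
  obtain ⟨hpos, hlog⟩ := neg_log_pi_sball_le_explicit (N := N) (B := B) hη hη2
  exact creationPrice_SUN_of_volumeLetter μ F G w I m₀ U₀ hF0 hG0 hw0 hlam hδ hF hconv hGwin hIrel hpos hlog hFi hGI hA' hB'

/-- **WHEN THE STEP SELLS `e^{−P}`, EXPLICIT**: with `∫F dκ ≤ 1` the factor of `creationPrice_SUN_explicit` is `≤ e^{−P}` as soon as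
`P + i₀ + #bonds·((N² − 1)·log η⁻¹ + c_N) ≤ (λ∕2)δ′²`. [folklore] -/
theorem creationPrice_SUN_explicit_factor_le_exp_neg {i₀ lam δ' A P η : ℝ} {n : ℕ} {N' : ℝ} (hA1 : A ≤ 1)
    (hledger : P + i₀ + (n : ℝ) * ((N' ^ 2 - 1) * Real.log η⁻¹ + ((N' ^ 2 - 1) / 2 * Real.log N' + N' ^ 2 * Real.log (16 * π + 2) + Real.log (2 * N' + 1) - Real.log (4 * π))) ≤ lam / 2 * δ' ^ 2) :
    exp (i₀ - lam / 2 * δ' ^ 2 + (n : ℝ) * ((N' ^ 2 - 1) * Real.log η⁻¹ + ((N' ^ 2 - 1) / 2 * Real.log N' + N' ^ 2 * Real.log (16 * π + 2) + Real.log (2 * N' + 1) - Real.log (4 * π)))) * A ≤ exp (-P) :=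
  creationPrice_factor_le_exp_neg_of_volumeLetter hA1 hledger

end Summit.QuantumFields.BalabanUV.T4Continuum.NE7b.CompactFibreCreationFloorSUNSharp

end
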